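import Summits.ResolutionOfSingularities.ResolutionOfSingularities.Theorems.FrobeniusClosingSteerJacobianLengthFrames
import Summits.ResolutionOfSingularities.ResolutionOfSingularities.Theorems.FrobeniusClosingSteerNestedCohenFramesSeparable
import HarnessLib

/-!
# Crux `Steer` (stmt-ResolutionOfSingularities-16345), chain W4.1, K3ᴳ / ℓ-COMPARISON: the comparison for the COMPLETED map, frames eliminated

OURS (campaign `res-hironaka`, rung L ★L-G4, slot W4.1; seat res-L0-w41-stub-2 g6; `K3G/JacobianLengthEtale-PLAN.md` §v1.2 last mile, first half).
Theses-free, definition-free. `JacobianLength.length_quotient_span_derivation_le_of_frames` (p568046) + `NestedFrames.exists_nested_frame_of_separable`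
(p568373) + `NestedFrames.exists_frame_with_section`: for regular local `S, S′` of characteristic `p` and dimension `n`, a ring map `φ : S → S′` with
`𝔪_S S′ = 𝔪_{S′}` (UNRAMIFIED), a completed map `ψ : Ŝ → Ŝ′` over `φ` which is local and RESIDUALLY SEPARABLE with `κ(Ŝ′)` finite free over `κ(Ŝ)`
(explicit basis in sum form), and a finite `p`-basis dual frame of `κ(Ŝ)` whose derivations extend along `κ(ψ)`: `ℓ(Ŝ′ ⧸ 𝒥(φ f)) ≤ ℓ(Ŝ ⧸ 𝒥(f))`.
No Cohen frame appears in the statement. What the K3ᴳ producer still supplies: `ψ` (`Isol.exists_ringHom_adicCompletion_extend`), the residue data of the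
étale-local enlargement read on the completions (`AdicCompletion.residueField_map_bijective`), and the 2-frame (`GeomTwoBasis`, K-GG5). [cite: Matsumura1987, Thm. 28.3, Thm. 30.6] [folklore]

* `JacobianLength.length_quotient_span_derivation_le_of_completed`.
-/

noncomputable section

set_option linter.dupNamespace false

open IsLocalRing MvPowerSeries
open Literature.AlgebraicGeometry.Resolution Literature.FieldTheory.Separability
open Summit.ResolutionOfSingularities.ResolutionOfSingularities.Theorems.SwitchingDichotomy

namespace Summit.ResolutionOfSingularities.ResolutionOfSingularities.Theorems.SwitchingDichotomy.JacobianLength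

/-- **ℓ-comparison for the completed map (frames eliminated).** See the module docstring. [cite: Matsumura1987, Thm. 28.3, Thm. 30.6] [folklore] -/
theorem length_quotient_span_derivation_le_of_completed (p : ℕ) [Fact p.Prime]
    {S S' : Type} [CommRing S] [CommRing S'] [IsRegularLocalRing S] [IsRegularLocalRing S'] [CharP S p] [CharP S' p]
    (φ : S →+* S') (hunr : (maximalIdeal S).map φ = maximalIdeal S')
    {n : ℕ} (hS : ringKrullDim S = n) (hS' : ringKrullDim S' = n)
    (ψ : AdicCompletion (maximalIdeal S) S →+* AdicCompletion (maximalIdeal S') S') [IsLocalHom ψ]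
    (hψ : ∀ s, ψ (algebraMap S _ s) = algebraMap S' _ (φ s))
    (hsep : @Algebra.IsSeparable (ResidueField (AdicCompletion (maximalIdeal S) S)) (ResidueField (AdicCompletion (maximalIdeal S') S')) _ _
      (ResidueField.map ψ).toAlgebra)
    {ι : Type} [Fintype ι] (b : ι → ResidueField (AdicCompletion (maximalIdeal S') S'))
    (hb : ∀ c, ∃! g : ι → ResidueField (AdicCompletion (maximalIdeal S) S), c = ∑ j, ResidueField.map ψ (g j) * b j)
    [CharP (ResidueField (AdicCompletion (maximalIdeal S) S)) p]
    {r : ℕ} (γ : Fin r → ResidueField (AdicCompletion (maximalIdeal S) S))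
    (D : Fin r → Derivation ℤ (ResidueField (AdicCompletion (maximalIdeal S) S)) (ResidueField (AdicCompletion (maximalIdeal S) S)))
    (hdual : ∀ l l', D l (γ l') = if l' = l then 1 else 0) (hgen : pAdjoin p (Set.range γ) = ⊤)
    (D' : Fin r → Derivation ℤ (ResidueField (AdicCompletion (maximalIdeal S') S')) (ResidueField (AdicCompletion (maximalIdeal S') S')))
    (hD' : ∀ l a, D' l (ResidueField.map ψ a) = ResidueField.map ψ (D l a)) (f : S) :
    Module.length (AdicCompletion (maximalIdeal S') S') (AdicCompletion (maximalIdeal S') S' ⧸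
        Ideal.span (Set.range fun Dv : Derivation ℤ (AdicCompletion (maximalIdeal S') S') (AdicCompletion (maximalIdeal S') S') =>
          Dv (algebraMap S' (AdicCompletion (maximalIdeal S') S') (φ f)))) ≤
      Module.length (AdicCompletion (maximalIdeal S) S) (AdicCompletion (maximalIdeal S) S ⧸
        Ideal.span (Set.range fun Dv : Derivation ℤ (AdicCompletion (maximalIdeal S) S) (AdicCompletion (maximalIdeal S) S) =>
          Dv (algebraMap S (AdicCompletion (maximalIdeal S) S) f))) := by
  classical
  haveI : IsNoetherianRing (AdicCompletion (maximalIdeal S) S) := isNoetherianRing_adicCompletion_maximalIdeal S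
  haveI : IsRegularLocalRing (AdicCompletion (maximalIdeal S) S) := isRegularLocalRing_adicCompletion S
  haveI : IsNoetherianRing (AdicCompletion (maximalIdeal S') S') := isNoetherianRing_adicCompletion_maximalIdeal S'
  haveI : IsRegularLocalRing (AdicCompletion (maximalIdeal S') S') := isRegularLocalRing_adicCompletion S'
  -- the coefficient algebra `κ(Ŝ) → κ(Ŝ′)` and its basis
  letI algκ : Algebra (ResidueField (AdicCompletion (maximalIdeal S) S)) (ResidueField (AdicCompletion (maximalIdeal S') S')) :=
    (ResidueField.map ψ).toAlgebra
  have halg : ∀ a, algebraMap (ResidueField (AdicCompletion (maximalIdeal S) S)) (ResidueField (AdicCompletion (maximalIdeal S') S')) a =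
      ResidueField.map ψ a := fun a => rfl
  have hli : LinearIndependent (ResidueField (AdicCompletion (maximalIdeal S) S)) b := by
    rw [Fintype.linearIndependent_iff]
    intro g hg j
    have h0 := (hb 0).unique (y₁ := g) (y₂ := 0) (by
      rw [← hg]; refine Finset.sum_congr rfl fun i _ => ?_; rw [Algebra.smul_def, halg]) (by simp)
    exact congrFun h0 j
  have hsp : ⊤ ≤ Submodule.span (ResidueField (AdicCompletion (maximalIdeal S) S)) (Set.range b) := by
    rintro c -
    obtain ⟨g, hg, -⟩ := hb c
    rw [hg]
    refine Submodule.sum_mem _ fun j _ => ?_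
    rw [← halg, ← Algebra.smul_def]
    exact Submodule.smul_mem _ _ (Submodule.subset_span ⟨j, rfl⟩)
  let B : Module.Basis ι (ResidueField (AdicCompletion (maximalIdeal S) S)) (ResidueField (AdicCompletion (maximalIdeal S') S')) :=
    Module.Basis.mk hli hsp
  -- regular systems of parameters: `x` of `S`, `φ ∘ x` of `S′`, completed
  have hfin : (maximalIdeal S).spanFinrank = n := by
    have h := IsRegularLocalRing.spanFinrank_maximalIdeal (R := S)
    rw [hS] at h
    exact_mod_cast h
  obtain ⟨v₀, hv₀⟩ := exists_regularSystemOfParameters (R := S)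
  let x : Fin n → S := fun i => v₀ (Fin.cast hfin.symm i)
  have hx : Ideal.span (Set.range x) = maximalIdeal S := by
    rw [← hv₀]; congr 1; ext s; constructor
    · rintro ⟨i, rfl⟩; exact ⟨_, rfl⟩
    · rintro ⟨j, rfl⟩; exact ⟨Fin.cast hfin j, by simp [x]⟩
  have hy : Ideal.span (Set.range fun i => φ (x i)) = maximalIdeal S' := by
    rw [← hunr, ← hx, Ideal.map_span, ← Set.range_comp]; rfl
  obtain ⟨σA, frameA, hσA, hfAx, hfAσ, -⟩ := NestedFrames.exists_frame_with_section p hS x hx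
  have hnB : (maximalIdeal (AdicCompletion (maximalIdeal S') S')).spanFinrank = n := by
    rw [AdicCompletion.spanFinrank_maximalIdeal_eq]
    have h := IsRegularLocalRing.spanFinrank_maximalIdeal (R := S')
    rw [hS'] at h
    exact_mod_cast h
  have hxhat : Ideal.span (Set.range fun i => algebraMap S (AdicCompletion (maximalIdeal S) S) (x i)) =
      maximalIdeal (AdicCompletion (maximalIdeal S) S) := by
    rw [AdicCompletion.maximalIdeal_eq_map, ← hx, Ideal.map_span, ← Set.range_comp]; rfl
  have hyhat : Ideal.span (Set.range fun i => algebraMap S' (AdicCompletion (maximalIdeal S') S') (φ (x i))) =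
      maximalIdeal (AdicCompletion (maximalIdeal S') S') := by
    rw [AdicCompletion.maximalIdeal_eq_map, ← hy, Ideal.map_span, ← Set.range_comp]; rfl
  obtain ⟨frameB, σB, -, -, -, -, hsq⟩ := NestedFrames.exists_nested_frame_of_separable ψ hnB _ hxhat _ hyhat (fun i => hψ (x i))
    σA hσA frameA hfAx hfAσ hsep
  -- the comparison in frames, then `ψ f̂ = (φ f)^`
  have key := length_quotient_span_derivation_le_of_frames p ψ B frameA frameB (fun t => by rw [hsq t]; rfl) γ D hdual hgen D'
    (fun l a => by rw [halg]; exact hD' l a) (algebraMap S (AdicCompletion (maximalIdeal S) S) f)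
  rwa [hψ] at key

end Summit.ResolutionOfSingularities.ResolutionOfSingularities.Theorems.SwitchingDichotomy.JacobianLength

end
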